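import Mathlib
import Summits.Ventures.PercRepro2.Defs
import Summits.Ventures.PercRepro2.Independence
import Summits.Ventures.PercRepro2.Harris
import Summits.Ventures.PercRepro2.Graph
import Summits.Ventures.PercRepro2.Exploration
import Summits.Ventures.PercRepro2.Events
import Summits.Ventures.PercRepro2.Induced
import Summits.Ventures.PercRepro2.BHKEvents
import Summits.Ventures.PercRepro2.BHKAvoid
import Summits.Ventures.PercRepro2.R4Defs
import Summits.Ventures.PercRepro2.R4Ladder
import Summits.Ventures.PercRepro2.StarRoot

/-!
# Star-attached roots: the four cells of the `(o ∈ U?, b ∈ U?)` table (blind cell PercRepro2, p1)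

With `U = C(a₂)`, `o` star-attached to `S = {a₁, a₂, b}` (`o ∉ S`), `ω' = delConfig ends {o} ω`,
the hit events `hitEdge ends o x` and the states `S₀` (`stateNone`), `S₁` (`stateTwoB`),
`S₂` (`stateOneB`) of `{a₁, a₂, b}` in `ω'`, the four cells are (`cell00_eq` … `cell11_eq`):
`x₀₀ = A₂ᶜ ∩ (S₀ ∪ S₂)`, `x₀₁ = A₂ᶜ ∩ Bᶜ ∩ S₁`, `x₁₀ = A₂ ∩ Bᶜ ∩ Γᶜ ∩ (S₀ ∪ S₂)`,
`x₁₁ = Γᶜ ∩ ((S₁ ∩ (A₂ ∪ B)) ∪ (S₀ ∩ A₂ ∩ B))` — LEAD-PROOFSHAPES §8.7 (9).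
-/

namespace Summit.Ventures.PercRepro2

/-! ## The four cells of the `(o ∈ U?, b ∈ U?)` table for a star-attached root -/

section StarEvents

variable {V : Type*} {E : Type*} [DecidableEq V] {ends : E → Sym2 V} {o a₁ a₂ b : V}

/-- The five states of `{a₁, a₂, b}` in `ω' = delConfig ends {o} ω`: `S₀` pairwise disconnected. -/
def stateNone (ends : E → Sym2 V) (o a₁ a₂ b : V) : Set (Config E) :=
  {ω | ¬ Conn ends (delConfig ends {o} ω) a₂ a₁ ∧ ¬ Conn ends (delConfig ends {o} ω) a₂ b ∧
    ¬ Conn ends (delConfig ends {o} ω) a₁ b}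

/-- `S₁`: `a₂ ↔ b`, `a₁` separate (in `ω'`). -/
def stateTwoB (ends : E → Sym2 V) (o a₁ a₂ b : V) : Set (Config E) :=
  {ω | Conn ends (delConfig ends {o} ω) a₂ b ∧ ¬ Conn ends (delConfig ends {o} ω) a₁ b}

/-- `S₂`: `a₁ ↔ b`, `a₂` separate (in `ω'`). -/
def stateOneB (ends : E → Sym2 V) (o a₁ a₂ b : V) : Set (Config E) :=
  {ω | Conn ends (delConfig ends {o} ω) a₁ b ∧ ¬ Conn ends (delConfig ends {o} ω) a₂ b}

/-- `{o ∈ U}`, `{b ∈ U}`, `{a₁ ∈ U}` for `U = C(a₂)` expressed through `ω'` and the hit events.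
Abbreviations for the proofs below. -/
lemma conn_a₂_iff (hS : StarAttached ends o {a₁, a₂, b}) (ho : o ∉ ({a₁, a₂, b} : Finset V))
    (ω : Config E) :
    (Conn ends ω a₂ o ↔ ω ∈ hitEdge ends o a₂ ∨
        (ω ∈ hitEdge ends o b ∧ Conn ends (delConfig ends {o} ω) a₂ b) ∨
        (ω ∈ hitEdge ends o a₁ ∧ Conn ends (delConfig ends {o} ω) a₂ a₁)) := by
  have ha₂ : a₂ ≠ o := fun h => ho (h ▸ Finset.mem_insert_of_mem (Finset.mem_insert_self _ _))
  rw [conn_to_star hS ha₂]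
  simp only [Finset.mem_insert, Finset.mem_singleton, exists_eq_or_imp, exists_eq_left]
  constructor
  · rintro (⟨h1, h2⟩ | ⟨h1, _⟩ | ⟨h1, h2⟩)
    · exact Or.inr (Or.inr ⟨h1, h2⟩)
    · exact Or.inl h1
    · exact Or.inr (Or.inl ⟨h1, h2⟩)
  · rintro (h1 | ⟨h1, h2⟩ | ⟨h1, h2⟩)
    · exact Or.inr (Or.inl ⟨h1, conn_refl _ _ _⟩)
    · exact Or.inr (Or.inr ⟨h1, h2⟩)
    · exact Or.inl ⟨h1, h2⟩


/-- `{b ∈ U}` through `ω'` and the hit events (`o ∉ {a₁, a₂, b}`). -/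
lemma conn_b_iff (hS : StarAttached ends o {a₁, a₂, b}) (ho : o ∉ ({a₁, a₂, b} : Finset V))
    (ω : Config E) :
    Conn ends ω a₂ b ↔ Conn ends (delConfig ends {o} ω) a₂ b ∨
      (Conn ends ω a₂ o ∧ ((ω ∈ hitEdge ends o a₂ ∧ Conn ends (delConfig ends {o} ω) a₂ b) ∨
        ω ∈ hitEdge ends o b ∨ (ω ∈ hitEdge ends o a₁ ∧ Conn ends (delConfig ends {o} ω) a₁ b))) := by
  have ha₂ : a₂ ≠ o := fun h => ho (h ▸ Finset.mem_insert_of_mem (Finset.mem_insert_self _ _))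
  have hb : b ≠ o := fun h => ho (h ▸ Finset.mem_insert_of_mem (Finset.mem_insert_of_mem
    (Finset.mem_singleton_self _)))
  rw [conn_star_iff hS ho ha₂ hb, conn_to_star hS ha₂]
  simp only [Finset.mem_insert, Finset.mem_singleton, exists_eq_or_imp, exists_eq_left]
  constructor
  · rintro (h | ⟨hr, h2⟩)
    · exact Or.inl h
    · refine Or.inr ⟨hr, ?_⟩
      rcases h2 with ⟨h1, h2⟩ | ⟨h1, h2⟩ | ⟨h1, _⟩
      · exact Or.inr (Or.inr ⟨h1, h2⟩)
      · exact Or.inl ⟨h1, h2⟩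
      · exact Or.inr (Or.inl h1)
  · rintro (h | ⟨hr, h2⟩)
    · exact Or.inl h
    · refine Or.inr ⟨hr, ?_⟩
      rcases h2 with ⟨h1, h2⟩ | h1 | ⟨h1, h2⟩
      · exact Or.inr (Or.inl ⟨h1, h2⟩)
      · exact Or.inr (Or.inr ⟨h1, conn_refl _ _ _⟩)
      · exact Or.inl ⟨h1, h2⟩

/-- `{a₁ ∈ U}` through `ω'` and the hit events (`o ∉ {a₁, a₂, b}`). -/
lemma conn_a₁_iff (hS : StarAttached ends o {a₁, a₂, b}) (ho : o ∉ ({a₁, a₂, b} : Finset V))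
    (ω : Config E) :
    Conn ends ω a₂ a₁ ↔ Conn ends (delConfig ends {o} ω) a₂ a₁ ∨
      (Conn ends ω a₂ o ∧ ((ω ∈ hitEdge ends o a₂ ∧ Conn ends (delConfig ends {o} ω) a₂ a₁) ∨
        (ω ∈ hitEdge ends o b ∧ Conn ends (delConfig ends {o} ω) b a₁) ∨ ω ∈ hitEdge ends o a₁)) := by
  have ha₂ : a₂ ≠ o := fun h => ho (h ▸ Finset.mem_insert_of_mem (Finset.mem_insert_self _ _))
  have ha₁ : a₁ ≠ o := fun h => ho (h ▸ Finset.mem_insert_self _ _)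
  rw [conn_star_iff hS ho ha₂ ha₁, conn_to_star hS ha₂]
  simp only [Finset.mem_insert, Finset.mem_singleton, exists_eq_or_imp, exists_eq_left]
  constructor
  · rintro (h | ⟨hr, h2⟩)
    · exact Or.inl h
    · refine Or.inr ⟨hr, ?_⟩
      rcases h2 with ⟨h1, _⟩ | ⟨h1, h2⟩ | ⟨h1, h2⟩
      · exact Or.inr (Or.inr h1)
      · exact Or.inl ⟨h1, h2⟩
      · exact Or.inr (Or.inl ⟨h1, h2⟩)
  · rintro (h | ⟨hr, h2⟩)
    · exact Or.inl h
    · refine Or.inr ⟨hr, ?_⟩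
      rcases h2 with ⟨h1, h2⟩ | ⟨h1, h2⟩ | h1
      · exact Or.inr (Or.inl ⟨h1, h2⟩)
      · exact Or.inr (Or.inr ⟨h1, h2⟩)
      · exact Or.inl ⟨h1, conn_refl _ _ _⟩


omit [DecidableEq V] in
/-- `Conn` is symmetric (iff form). -/
lemma conn_comm_iff {ω : Config E} {x y : V} : Conn ends ω x y ↔ Conn ends ω y x :=
  ⟨conn_symm, conn_symm⟩

/-- The atoms of the star computation, as a reusable tactic block: rewrites the three
memberships and introduces the six atoms. -/
lemma star_atoms (hS : StarAttached ends o {a₁, a₂, b}) (ho : o ∉ ({a₁, a₂, b} : Finset V))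
    (ω : Config E) :
    (Conn ends ω o a₂ ↔ (ω ∈ hitEdge ends o a₂ ∨
        (ω ∈ hitEdge ends o b ∧ Conn ends (delConfig ends {o} ω) a₂ b) ∨
        (ω ∈ hitEdge ends o a₁ ∧ Conn ends (delConfig ends {o} ω) a₂ a₁))) ∧
    (Conn ends ω a₂ b ↔ Conn ends (delConfig ends {o} ω) a₂ b ∨
      ((ω ∈ hitEdge ends o a₂ ∨
        (ω ∈ hitEdge ends o b ∧ Conn ends (delConfig ends {o} ω) a₂ b) ∨
        (ω ∈ hitEdge ends o a₁ ∧ Conn ends (delConfig ends {o} ω) a₂ a₁)) ∧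
        ((ω ∈ hitEdge ends o a₂ ∧ Conn ends (delConfig ends {o} ω) a₂ b) ∨
        ω ∈ hitEdge ends o b ∨ (ω ∈ hitEdge ends o a₁ ∧ Conn ends (delConfig ends {o} ω) a₁ b)))) ∧
    (Conn ends ω a₂ a₁ ↔ Conn ends (delConfig ends {o} ω) a₂ a₁ ∨
      ((ω ∈ hitEdge ends o a₂ ∨
        (ω ∈ hitEdge ends o b ∧ Conn ends (delConfig ends {o} ω) a₂ b) ∨
        (ω ∈ hitEdge ends o a₁ ∧ Conn ends (delConfig ends {o} ω) a₂ a₁)) ∧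
        ((ω ∈ hitEdge ends o a₂ ∧ Conn ends (delConfig ends {o} ω) a₂ a₁) ∨
        (ω ∈ hitEdge ends o b ∧ Conn ends (delConfig ends {o} ω) a₁ b) ∨ ω ∈ hitEdge ends o a₁))) := by
  refine ⟨?_, ?_, ?_⟩
  · rw [conn_comm_iff (x := o), conn_a₂_iff hS ho ω]
  · rw [conn_b_iff hS ho ω, conn_a₂_iff hS ho ω]
  · rw [conn_a₁_iff hS ho ω, conn_a₂_iff hS ho ω, conn_comm_iff (x := b) (y := a₁)]

/-- Cell `x₀₀ = {o ∉ U, a₁ ∉ U, b ∉ U} = {no open o–a₂ edge} ∩ (S₀ ∪ S₂)`. -/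
lemma cell00_eq (hS : StarAttached ends o {a₁, a₂, b}) (ho : o ∉ ({a₁, a₂, b} : Finset V)) :
    (connEvent ends o a₂)ᶜ ∩ avoidAll ends a₂ {a₁, b} =
      (hitEdge ends o a₂)ᶜ ∩ (stateNone ends o a₁ a₂ b ∪ stateOneB ends o a₁ a₂ b) := by
  ext ω
  obtain ⟨e1, e2, e3⟩ := star_atoms hS ho ω
  have t3 : Conn ends (delConfig ends {o} ω) a₂ a₁ → Conn ends (delConfig ends {o} ω) a₁ b →
      Conn ends (delConfig ends {o} ω) a₂ b := fun h1 h2 => conn_trans h1 h2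
  simp only [Set.mem_inter_iff, Set.mem_compl_iff, Set.mem_union, mem_connEvent, mem_avoidAll,
    Finset.mem_insert, Finset.mem_singleton, forall_eq_or_imp, forall_eq, stateNone, stateOneB,
    Set.mem_setOf_eq]
  rw [e1, e2, e3]
  set A := ω ∈ hitEdge ends o a₂
  set B := ω ∈ hitEdge ends o b
  set G := ω ∈ hitEdge ends o a₁
  set c21 := Conn ends (delConfig ends {o} ω) a₂ a₁
  set c2b := Conn ends (delConfig ends {o} ω) a₂ b
  set c1b := Conn ends (delConfig ends {o} ω) a₁ b
  constructor
  · rintro ⟨hr, h1, h2⟩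
    have hA : ¬ A := fun h => hr (Or.inl h)
    have h21 : ¬ c21 := fun h => h1 (Or.inl h)
    have h2b : ¬ c2b := fun h => h2 (Or.inl h)
    refine ⟨hA, ?_⟩
    by_cases h1b : c1b
    · exact Or.inr ⟨h1b, h2b⟩
    · exact Or.inl ⟨h21, h2b, h1b⟩
  · rintro ⟨hA, hst⟩
    have h21 : ¬ c21 := by
      rcases hst with ⟨h, _, _⟩ | ⟨h1b, h2b⟩
      · exact h
      · exact fun h => h2b (t3 h h1b)
    have h2b : ¬ c2b := by
      rcases hst with ⟨_, h, _⟩ | ⟨_, h⟩ <;> exact h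
    have hr : ¬ (A ∨ (B ∧ c2b) ∨ (G ∧ c21)) := by
      rintro (h | ⟨_, h⟩ | ⟨_, h⟩)
      · exact hA h
      · exact h2b h
      · exact h21 h
    exact ⟨hr, fun h => h.elim h21 (fun h' => hr h'.1), fun h => h.elim h2b (fun h' => hr h'.1)⟩


/-- Cell `x₀₁ = {o ∉ U, b ∈ U, a₁ ∉ U} = {no open o–a₂, no open o–b} ∩ S₁`. -/
lemma cell01_eq (hS : StarAttached ends o {a₁, a₂, b}) (ho : o ∉ ({a₁, a₂, b} : Finset V)) :
    (connEvent ends o a₂)ᶜ ∩ connEvent ends a₂ b ∩ (connEvent ends a₂ a₁)ᶜ =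
      (hitEdge ends o a₂)ᶜ ∩ (hitEdge ends o b)ᶜ ∩ stateTwoB ends o a₁ a₂ b := by
  ext ω
  obtain ⟨e1, e2, e3⟩ := star_atoms hS ho ω
  have t1 : Conn ends (delConfig ends {o} ω) a₂ a₁ → Conn ends (delConfig ends {o} ω) a₂ b →
      Conn ends (delConfig ends {o} ω) a₁ b := fun h1 h2 => conn_trans (conn_symm h1) h2
  have t2 : Conn ends (delConfig ends {o} ω) a₂ b → Conn ends (delConfig ends {o} ω) a₁ b →
      Conn ends (delConfig ends {o} ω) a₂ a₁ := fun h1 h2 => conn_trans h1 (conn_symm h2)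
  simp only [Set.mem_inter_iff, Set.mem_compl_iff, mem_connEvent, stateTwoB, Set.mem_setOf_eq]
  rw [e1, e2, e3]
  set A := ω ∈ hitEdge ends o a₂
  set B := ω ∈ hitEdge ends o b
  set G := ω ∈ hitEdge ends o a₁
  set c21 := Conn ends (delConfig ends {o} ω) a₂ a₁
  set c2b := Conn ends (delConfig ends {o} ω) a₂ b
  set c1b := Conn ends (delConfig ends {o} ω) a₁ b
  constructor
  · rintro ⟨⟨hr, hb⟩, h1⟩
    have h2b : c2b := hb.elim id (fun h => absurd h.1 hr)
    have h21 : ¬ c21 := fun h => h1 (Or.inl h)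
    refine ⟨⟨fun h => hr (Or.inl h), fun h => hr (Or.inr (Or.inl ⟨h, h2b⟩))⟩, h2b, fun h => h21 (t2 h2b h)⟩
  · rintro ⟨⟨hA, hB⟩, h2b, h1b⟩
    have h21 : ¬ c21 := fun h => h1b (t1 h h2b)
    have hr : ¬ (A ∨ (B ∧ c2b) ∨ (G ∧ c21)) := by
      rintro (h | ⟨h, _⟩ | ⟨_, h⟩)
      · exact hA h
      · exact hB h
      · exact h21 h
    exact ⟨⟨hr, Or.inl h2b⟩, fun h => h.elim h21 (fun h' => hr h'.1)⟩

/-- Cell `x₁₀ = {o ∈ U, a₁ ∉ U, b ∉ U} = {open o–a₂} ∩ {no open o–b} ∩ {no open o–a₁} ∩ (S₀ ∪ S₂)`. -/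
lemma cell10_eq (hS : StarAttached ends o {a₁, a₂, b}) (ho : o ∉ ({a₁, a₂, b} : Finset V)) :
    connEvent ends o a₂ ∩ avoidAll ends a₂ {a₁, b} =
      hitEdge ends o a₂ ∩ (hitEdge ends o b)ᶜ ∩ (hitEdge ends o a₁)ᶜ ∩
        (stateNone ends o a₁ a₂ b ∪ stateOneB ends o a₁ a₂ b) := by
  ext ω
  obtain ⟨e1, e2, e3⟩ := star_atoms hS ho ω
  have t3 : Conn ends (delConfig ends {o} ω) a₂ a₁ → Conn ends (delConfig ends {o} ω) a₁ b →
      Conn ends (delConfig ends {o} ω) a₂ b := fun h1 h2 => conn_trans h1 h2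
  simp only [Set.mem_inter_iff, Set.mem_compl_iff, Set.mem_union, mem_connEvent, mem_avoidAll,
    Finset.mem_insert, Finset.mem_singleton, forall_eq_or_imp, forall_eq, stateNone, stateOneB,
    Set.mem_setOf_eq]
  rw [e1, e2, e3]
  set A := ω ∈ hitEdge ends o a₂
  set B := ω ∈ hitEdge ends o b
  set G := ω ∈ hitEdge ends o a₁
  set c21 := Conn ends (delConfig ends {o} ω) a₂ a₁
  set c2b := Conn ends (delConfig ends {o} ω) a₂ b
  set c1b := Conn ends (delConfig ends {o} ω) a₁ b
  constructor
  · rintro ⟨hr, h1, h2⟩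
    have h21 : ¬ c21 := fun h => h1 (Or.inl h)
    have h2b : ¬ c2b := fun h => h2 (Or.inl h)
    have hG : ¬ G := fun h => h1 (Or.inr ⟨hr, Or.inr (Or.inr h)⟩)
    have hB : ¬ B := fun h => h2 (Or.inr ⟨hr, Or.inr (Or.inl h)⟩)
    have hA : A := by
      rcases hr with h | ⟨h, _⟩ | ⟨h, _⟩
      · exact h
      · exact absurd h hB
      · exact absurd h hG
    refine ⟨⟨⟨hA, hB⟩, hG⟩, ?_⟩
    by_cases h1b : c1b
    · exact Or.inr ⟨h1b, h2b⟩
    · exact Or.inl ⟨h21, h2b, h1b⟩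
  · rintro ⟨⟨⟨hA, hB⟩, hG⟩, hst⟩
    have h21 : ¬ c21 := by
      rcases hst with ⟨h, _, _⟩ | ⟨h1b, h2b⟩
      · exact h
      · exact fun h => h2b (t3 h h1b)
    have h2b : ¬ c2b := by
      rcases hst with ⟨_, h, _⟩ | ⟨_, h⟩ <;> exact h
    refine ⟨Or.inl hA, ?_, ?_⟩
    · rintro (h | ⟨_, ⟨_, h⟩ | ⟨h, _⟩ | h⟩)
      · exact h21 h
      · exact h21 h
      · exact hB h
      · exact hG h
    · rintro (h | ⟨_, ⟨_, h⟩ | h | ⟨h, _⟩⟩)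
      · exact h2b h
      · exact h2b h
      · exact hB h
      · exact hG h

/-- Cell `x₁₁ = {o ∈ U, b ∈ U, a₁ ∉ U} = {no open o–a₁} ∩ ((S₁ ∩ {open o–a₂ or o–b}) ∪ (S₀ ∩ {open o–a₂} ∩ {open o–b}))`. -/
lemma cell11_eq (hS : StarAttached ends o {a₁, a₂, b}) (ho : o ∉ ({a₁, a₂, b} : Finset V)) :
    connEvent ends o a₂ ∩ connEvent ends a₂ b ∩ (connEvent ends a₂ a₁)ᶜ =
      (hitEdge ends o a₁)ᶜ ∩ ((stateTwoB ends o a₁ a₂ b ∩ (hitEdge ends o a₂ ∪ hitEdge ends o b)) ∪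
        (stateNone ends o a₁ a₂ b ∩ hitEdge ends o a₂ ∩ hitEdge ends o b)) := by
  ext ω
  obtain ⟨e1, e2, e3⟩ := star_atoms hS ho ω
  have t1 : Conn ends (delConfig ends {o} ω) a₂ a₁ → Conn ends (delConfig ends {o} ω) a₂ b →
      Conn ends (delConfig ends {o} ω) a₁ b := fun h1 h2 => conn_trans (conn_symm h1) h2
  have t2 : Conn ends (delConfig ends {o} ω) a₂ b → Conn ends (delConfig ends {o} ω) a₁ b →
      Conn ends (delConfig ends {o} ω) a₂ a₁ := fun h1 h2 => conn_trans h1 (conn_symm h2)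
  simp only [Set.mem_inter_iff, Set.mem_compl_iff, Set.mem_union, mem_connEvent, stateNone,
    stateTwoB, Set.mem_setOf_eq]
  rw [e1, e2, e3]
  set A := ω ∈ hitEdge ends o a₂
  set B := ω ∈ hitEdge ends o b
  set G := ω ∈ hitEdge ends o a₁
  set c21 := Conn ends (delConfig ends {o} ω) a₂ a₁
  set c2b := Conn ends (delConfig ends {o} ω) a₂ b
  set c1b := Conn ends (delConfig ends {o} ω) a₁ b
  constructor
  · rintro ⟨⟨hr, hb⟩, h1⟩
    have h21 : ¬ c21 := fun h => h1 (Or.inl h)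
    have hG : ¬ G := fun h => h1 (Or.inr ⟨hr, Or.inr (Or.inr h)⟩)
    have hB1 : ¬ (B ∧ c1b) := fun h => h1 (Or.inr ⟨hr, Or.inr (Or.inl h)⟩)
    refine ⟨hG, ?_⟩
    by_cases h2b : c2b
    · have h1b : ¬ c1b := fun h => h21 (t2 h2b h)
      refine Or.inl ⟨⟨h2b, h1b⟩, ?_⟩
      rcases hr with h | ⟨h, _⟩ | ⟨h, _⟩
      · exact Or.inl h
      · exact Or.inr h
      · exact absurd h hG
    · have hB : B := by
        rcases hb with h | ⟨_, ⟨_, h⟩ | h | ⟨h, _⟩⟩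
        · exact absurd h h2b
        · exact absurd h h2b
        · exact h
        · exact absurd h hG
      have h1b : ¬ c1b := fun h => hB1 ⟨hB, h⟩
      have hA : A := by
        rcases hr with h | ⟨_, h⟩ | ⟨h, _⟩
        · exact h
        · exact absurd h h2b
        · exact absurd h hG
      exact Or.inr ⟨⟨⟨h21, h2b, h1b⟩, hA⟩, hB⟩
  · rintro ⟨hG, ⟨⟨h2b, h1b⟩, hab⟩ | ⟨⟨⟨h21, h2b, h1b⟩, hA⟩, hB⟩⟩
    · have h21 : ¬ c21 := fun h => h1b (t1 h h2b)
      have hr : A ∨ (B ∧ c2b) ∨ (G ∧ c21) := by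
        rcases hab with h | h
        · exact Or.inl h
        · exact Or.inr (Or.inl ⟨h, h2b⟩)
      refine ⟨⟨hr, Or.inl h2b⟩, ?_⟩
      rintro (h | ⟨_, ⟨_, h⟩ | ⟨_, h⟩ | h⟩)
      · exact h21 h
      · exact h21 h
      · exact h1b h
      · exact hG h
    · have hr : A ∨ (B ∧ c2b) ∨ (G ∧ c21) := Or.inl hA
      refine ⟨⟨hr, Or.inr ⟨hr, Or.inr (Or.inl hB)⟩⟩, ?_⟩
      rintro (h | ⟨_, ⟨_, h⟩ | ⟨_, h⟩ | h⟩)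
      · exact h21 h
      · exact h21 h
      · exact h1b h
      · exact hG h

end StarEvents

end Summit.Ventures.PercRepro2
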